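import Literature.AlgebraicGeometry.GroupSchemes.FirstOrderPointsAdditive
import HarnessLib

/-!
# Drinfeld's rigidity lemma, first-order case: over a local ring `A` with `N · 1_A = 0`, a point of a monoid scheme which is the
# unit modulo a square-zero ideal is killed by `N` ([Katz1981SerreTate] §1.1 Lemmas 1.1.1–1.1.2, `ν = 1`, scheme form)

Topic `Literature/AlgebraicGeometry/GroupSchemes`, namespace `Literature.AlgebraicGeometry.GroupSchemes.ReductionKernel`.
THEOREMS ONLY (no definition, no named fact, no instance, no notation, no `sorry`).  Sequel of ★
`GroupSchemes/FirstOrderPointsAdditive` (the chart-level statement `pow_eq_one_of_charts`: «the monoid law is additive on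
first-order points, so `N` kills them when `N` kills the square-zero ideal», [GortzWedhorn2023] Remark 27.18 (3)–(4)); here the
two affine charts (`V ∋` unit section of `Y`, `V₂ ⊆ pr₁⁻¹V ∩ pr₂⁻¹V ∩ μ⁻¹V` in `Y ×_S Y` through the unit) are PRODUCED over a
LOCAL base ring, giving the hypothesis-free heads.  Cell `pub/hodgecm-mathlib` (D-0151 ∕ D-0183 floor 0), programme P6 «MOD»,
sub-line P6b (`Cruxes/HLiu418/Lines/F0_P6b_BTSerreTate.lean`, socket `stub_L4B1ff_serreTateHomLift`, Drinfeld inputs (D1)∕(D2):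
injectivity of `Hom(X, Y) → Hom(X₀, Y₀)` for abelian schemes and for their Barsotti–Tate groups along a small surjection of
Artinian local rings with `p` nilpotent); generic, count-neutral capital `--supports stmt-HodgeConjecture-24832`.  HONEST LABEL:
HC_CM is proved only modulo the cell's 2 remaining named inputs (hLiu418 24832, h413 24833) until rung 0 closes; no letter paid.

THE PRINT.  [Katz1981SerreTate] §1.1: `R` a ring, `N ≥ 1` with `N · 1_R = 0`, `I ⊂ R` with `I^{ν+1} = 0`, `R₀ = R∕I`;
`G_I(T) := Ker(G(T) → G(T mod I))`.  LEMMA 1.1.1 (`G` a commutative formal Lie group over `R`): `N^ν` kills `G_I`.  LEMMA 1.1.2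
(`G` an fppf abelian sheaf with `Ĝ` a formal Lie group): `N^ν` kills `G_I`.  THIS FILE: the case `ν = 1` (square-zero `I`,
which is the case `𝔪_A · J = 0` of the Artinian small extensions of Serre–Tate ∕ [RapoportSmithlingZhang2020Diagonal] Thm. 4.1)
for an ARBITRARY monoid object `Y` of `Over (Spec A)`, `A` LOCAL — no smoothness, no commutativity, no formal Lie group: the
first-order kernel of reduction of any monoid scheme is a module (★ `FirstOrderPoint.chart_pow_sub_chart_one`).

* `exists_unit_charts` — over a local ring, affine opens `V ∋ e(Spec A)` of `Y` and `V₂ ∋ (e,e)(Spec A)` of `Y ×_S Y` with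
  `V₂ ⊆ pr₁⁻¹V ∩ pr₂⁻¹V ∩ μ⁻¹V` exist (affine opens form a basis, Mathlib `exists_isAffineOpen_mem_and_subset`; an open of
  `Spec A` containing the closed point is everything, Mathlib `Scheme.preimage_eq_top_of_closedPoint_mem`);
* **`pow_eq_one_of_forall_mul_eq_zero`** — `A` local, `π : B ↠ B₀` a surjection of rings with `(ker π)² = 0` (`B` an
  `A`-algebra, `T = Spec B ⊇ T₀ = Spec B₀`), `N` killing `ker π`, `y ∈ Y(T)` with `y|_{T₀} = 1` ⟹ `y ^ N = 1`;
* **`pow_eq_one_of_natCast_eq_zero`** — the same with the printed hypothesis `N · 1_A = 0`;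
* **`pow_eq_one_of_isAffine`** ∕ `pow_eq_one_of_isAffine_of_natCast_eq_zero` — `Y` AFFINE over ANY ring `A` (charts `V = ⊤`,
  `V₂ = ⊤`; e.g. the finite layers of a Barsotti–Tate group — the (D2) input of `stub_L4B1ff`, asked by F0P6-p16 for the (G5) debt).

Not here (sequels): the iterate along `I^{ν+1} = 0` (`y ^ (N^ν) = 1`), the non-affine test scheme ∕ base-change-square form
(`IsBaseChangeVia` currency of the P6b line), and [Katz1981SerreTate] Lemma 1.1.3 (1)–(4).

## References
* [Katz1981SerreTate] N. M. Katz, *Serre–Tate local moduli*, LNM 868 (1981), exp. Vbis, §1.1 Lemmas 1.1.1–1.1.2 (pp. 138–140).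
* [GortzWedhorn2023] U. Görtz, T. Wedhorn, *Algebraic Geometry II* (2023), Remark 27.18 (3)–(4), (27.4.6).
* [RapoportSmithlingZhang2020Diagonal] M. Rapoport, B. Smithling, W. Zhang, *Arithmetic diagonal cycles on unitary Shimura
  varieties*, Compos. Math. 156 (2020), §4.1 Thm. 4.1 (p. 17) — the consumer (smoothness of `𝓜` via Serre–Tate).
-/

noncomputable section

set_option backward.isDefEq.respectTransparency false

universe u

open CategoryTheory CategoryTheory.Limits AlgebraicGeometry MonoidalCategory CartesianMonoidalCategory
open scoped MonObj

namespace Literature.AlgebraicGeometry.GroupSchemes.ReductionKernel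

open Literature.AlgebraicGeometry.Deformation Literature.AlgebraicGeometry.GroupSchemes.FirstOrderPoint

/-! ### §1 Over a LOCAL ring the unit charts exist -/

section Local

variable {A : Type u} [CommRing A] [IsLocalRing A]

/-- Over a local ring `A`, every monoid object `Y` of `Over (Spec A)` has an affine open `V ∋` the unit section and an
affine open `V₂ ⊆ pr₁⁻¹V ∩ pr₂⁻¹V ∩ μ⁻¹V` of `Y ×_S Y` through the unit (affine opens form a basis; an open of
`Spec A` containing the closed point is everything, Mathlib `Scheme.preimage_eq_top_of_closedPoint_mem`).
[cite: Katz1981SerreTate, §1.1] -/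
theorem exists_unit_charts (Y : Over (Spec (CommRingCat.of A))) [MonObj Y] :
    ∃ (V : Y.left.Opens) (V₂ : (Y ⊗ Y).left.Opens), IsAffineOpen V ∧ IsAffineOpen V₂ ∧
      (η[Y] : 𝟙_ _ ⟶ Y).left ⁻¹ᵁ V = ⊤ ∧ V₂ ≤ (fst Y Y).left ⁻¹ᵁ V ∧ V₂ ≤ (snd Y Y).left ⁻¹ᵁ V ∧
      V₂ ≤ (μ[Y] : Y ⊗ Y ⟶ Y).left ⁻¹ᵁ V ∧ (lift η[Y] η[Y] : 𝟙_ _ ⟶ Y ⊗ Y).left ⁻¹ᵁ V₂ = ⊤ := by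
  obtain ⟨V, hV, hxV, -⟩ := exists_isAffineOpen_mem_and_subset
    (X := Y.left) (x := (η[Y] : 𝟙_ _ ⟶ Y).left.base (IsLocalRing.closedPoint A)) (U := ⊤) trivial
  have hηV : (η[Y] : 𝟙_ _ ⟶ Y).left ⁻¹ᵁ V = ⊤ := Scheme.preimage_eq_top_of_closedPoint_mem _ hxV
  have hη1 : (η[Y] : 𝟙_ _ ⟶ Y) = 1 := by
    rw [Hom.one_def, toUnit_unit, Category.id_comp]
  have hf : (lift η[Y] η[Y] : 𝟙_ _ ⟶ Y ⊗ Y) ≫ fst Y Y = η[Y] := lift_fst _ _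
  have hs : (lift η[Y] η[Y] : 𝟙_ _ ⟶ Y ⊗ Y) ≫ snd Y Y = η[Y] := lift_snd _ _
  have hm : (lift η[Y] η[Y] : 𝟙_ _ ⟶ Y ⊗ Y) ≫ μ[Y] = η[Y] := by rw [hη1, ← Hom.mul_def, mul_one]
  have mem : ∀ (h : Y ⊗ Y ⟶ Y), (lift η[Y] η[Y] : 𝟙_ _ ⟶ Y ⊗ Y) ≫ h = η[Y] →
      (lift η[Y] η[Y] : 𝟙_ _ ⟶ Y ⊗ Y).left.base (IsLocalRing.closedPoint A) ∈ h.left ⁻¹ᵁ V := by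
    intro h e
    change ((lift η[Y] η[Y] : 𝟙_ _ ⟶ Y ⊗ Y).left ≫ h.left).base (IsLocalRing.closedPoint A) ∈ V
    rw [← Over.comp_left, e]
    exact hxV
  obtain ⟨V₂, hV₂, hzV₂, hV₂W⟩ := exists_isAffineOpen_mem_and_subset
    (U := (fst Y Y).left ⁻¹ᵁ V ⊓ (snd Y Y).left ⁻¹ᵁ V ⊓ (μ[Y] : Y ⊗ Y ⟶ Y).left ⁻¹ᵁ V)
    (show _ ∈ _ from ⟨⟨mem _ hf, mem _ hs⟩, mem _ hm⟩)
  have hle : V₂ ≤ (fst Y Y).left ⁻¹ᵁ V ⊓ (snd Y Y).left ⁻¹ᵁ V ⊓ (μ[Y] : Y ⊗ Y ⟶ Y).left ⁻¹ᵁ V := hV₂W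
  exact ⟨V, V₂, hV, hV₂, hηV, hle.trans (inf_le_left.trans inf_le_left), hle.trans (inf_le_left.trans inf_le_right),
    hle.trans inf_le_right, Scheme.preimage_eq_top_of_closedPoint_mem _ hzV₂⟩

/-! ### §2 The heads: `y ≡ 1 (mod T₀) ⇒ y ^ N = 1` -/

variable {Y : Over (Spec (CommRingCat.of A))} [MonObj Y]
  {B B₀ : Type u} [CommRing B] [CommRing B₀] [Algebra A B] (π : B →+* B₀)

/-- **Drinfeld's rigidity lemma, first-order case, over a LOCAL ring** ([Katz1981SerreTate] §1.1 Lemmas 1.1.1–1.1.2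
with `ν = 1`, for an arbitrary monoid scheme): `Y` a monoid object of `Over (Spec A)`, `π : B ↠ B₀` a surjection of
rings with `(ker π)² = 0` (`B` an `A`-algebra, `T = Spec B`, `T₀ = Spec B₀`), `N` an integer killing `ker π`.  Then
every `y ∈ Y(T)` with `y|_{T₀} = 1` satisfies `y ^ N = 1`.  [cite: Katz1981SerreTate, §1.1 Lemmas 1.1.1–1.1.2]
[cite: GortzWedhorn2023, Remark 27.18 (3)–(4)] -/
theorem pow_eq_one_of_forall_mul_eq_zero (hπ : Function.Surjective π) (hπ2 : RingHom.ker π ^ 2 = ⊥) {N : ℕ}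
    (hN : ∀ b, π b = 0 → (N : B) * b = 0)
    (y : Over.mk (Spec.map (CommRingCat.ofHom (algebraMap A B))) ⟶ Y)
    (hy : Spec.map (CommRingCat.ofHom π) ≫ y.left =
      Spec.map (CommRingCat.ofHom π) ≫ (1 : Over.mk (Spec.map (CommRingCat.ofHom (algebraMap A B))) ⟶ Y).left) :
    y ^ N = 1 := by
  obtain ⟨V, V₂, hV, hV₂, hηV, hfst, hsnd, hmul, hηV₂⟩ := exists_unit_charts Y
  exact pow_eq_one_of_charts π hV hV₂ hfst hsnd hmul hηV hηV₂ hπ hπ2 hN y hy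

/-- **Drinfeld's rigidity lemma, first-order case** ([Katz1981SerreTate] §1.1 Lemma 1.1.1 ∕ 1.1.2, `ν = 1`): if
`N · 1_A = 0`, then on any monoid scheme `Y` over the local ring `A` a `T`-point (`T = Spec B`) which is the unit
on a square-zero closed subscheme `Spec B₀` is killed by `N`. [cite: Katz1981SerreTate, §1.1 Lemmas 1.1.1–1.1.2] -/
theorem pow_eq_one_of_natCast_eq_zero (hπ : Function.Surjective π) (hπ2 : RingHom.ker π ^ 2 = ⊥) {N : ℕ}
    (hN : (N : A) = 0)
    (y : Over.mk (Spec.map (CommRingCat.ofHom (algebraMap A B))) ⟶ Y)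
    (hy : Spec.map (CommRingCat.ofHom π) ≫ y.left =
      Spec.map (CommRingCat.ofHom π) ≫ (1 : Over.mk (Spec.map (CommRingCat.ofHom (algebraMap A B))) ⟶ Y).left) :
    y ^ N = 1 := by
  refine pow_eq_one_of_forall_mul_eq_zero π hπ hπ2 (fun b _ => ?_) y hy
  rw [← map_natCast (algebraMap A B), hN, map_zero, zero_mul]

end Local

/-! ### §3 AFFINE monoid schemes over ANY ring: the charts are `V = ⊤`, `V₂ = ⊤` -/

section Affine

variable {A : Type u} [CommRing A] {Y : Over (Spec (CommRingCat.of A))} [MonObj Y] [IsAffine Y.left]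
  {B B₀ : Type u} [CommRing B] [CommRing B₀] [Algebra A B] (π : B →+* B₀)

/-- **Drinfeld's rigidity lemma, first-order case, for an AFFINE monoid scheme over ANY ring** (e.g. the layers of a
Barsotti–Tate group, finite over `Spec A`): `π : B ↠ B₀` with `(ker π)² = 0`, `N` killing `ker π`, `y ∈ Y(Spec B)` with
`y|_{Spec B₀} = 1` ⟹ `y ^ N = 1`.  No locality of `A` is needed: `Y` and `Y ×_S Y` are affine, so the whole spaces are the two
charts of ★ `FirstOrderPoint.pow_eq_one_of_charts`. [cite: Katz1981SerreTate, §1.1 Lemmas 1.1.1–1.1.2]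
[cite: GortzWedhorn2023, Remark 27.18 (3)–(4)] -/
theorem pow_eq_one_of_isAffine (hπ : Function.Surjective π) (hπ2 : RingHom.ker π ^ 2 = ⊥) {N : ℕ}
    (hN : ∀ b, π b = 0 → (N : B) * b = 0)
    (y : Over.mk (Spec.map (CommRingCat.ofHom (algebraMap A B))) ⟶ Y)
    (hy : Spec.map (CommRingCat.ofHom π) ≫ y.left =
      Spec.map (CommRingCat.ofHom π) ≫ (1 : Over.mk (Spec.map (CommRingCat.ofHom (algebraMap A B))) ⟶ Y).left) :
    y ^ N = 1 :=
  haveI : IsAffine (Y ⊗ Y).left := AlgebraicGeometry.Scheme.Pullback.isAffine_of_isAffine_isAffine_isAffine Y.hom Y.hom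
  pow_eq_one_of_charts π (V := ⊤) (V₂ := ⊤) (isAffineOpen_top Y.left) (isAffineOpen_top (Y ⊗ Y).left)
    (fun _ _ => trivial) (fun _ _ => trivial) (fun _ _ => trivial) rfl rfl hπ hπ2 hN y hy

/-- The same with the printed hypothesis `N · 1_A = 0`. [cite: Katz1981SerreTate, §1.1 Lemmas 1.1.1–1.1.2] -/
theorem pow_eq_one_of_isAffine_of_natCast_eq_zero (hπ : Function.Surjective π) (hπ2 : RingHom.ker π ^ 2 = ⊥) {N : ℕ}
    (hN : (N : A) = 0)
    (y : Over.mk (Spec.map (CommRingCat.ofHom (algebraMap A B))) ⟶ Y)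
    (hy : Spec.map (CommRingCat.ofHom π) ≫ y.left =
      Spec.map (CommRingCat.ofHom π) ≫ (1 : Over.mk (Spec.map (CommRingCat.ofHom (algebraMap A B))) ⟶ Y).left) :
    y ^ N = 1 := by
  refine pow_eq_one_of_isAffine π hπ hπ2 (fun b _ => ?_) y hy
  rw [← map_natCast (algebraMap A B), hN, map_zero, zero_mul]

end Affine

end Literature.AlgebraicGeometry.GroupSchemes.ReductionKernel

end
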